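import Summits.CriticalPhenomena.CardyFormulaZ2.Theses.DyadicBetaRigidity
import Literature.Probability.RandomPlanarGeometry.CardyFunctionIncBeta
import Literature.Probability.RandomPlanarGeometry.ConformalRectangleProofs
import Literature.Probability.Percolation.QuadCrossingSquareModel
import Literature.Barriers.CriticalPhenomena.QuarterTurnResistorLaw
import Summits.CriticalPhenomena.CardyFormulaZ2.Theorems.DyadicBetaRigidityDyadicBetaSufficesBeta
import Summits.CriticalPhenomena.CardyFormulaZ2.Theorems.CardyWhiteToColouredSimilarityUpgradeStubRectangleDuality

/-! # Disproof of DyadicLatticeBetaLaw — findings: NO KILL POSSIBLE SHORT OF ¬CardyFormulaZ2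

Seeded by the crux-attack refuter (refuter-rattack-stmt-CriticalPhenomena-18183-0, 2026-08-17, one cycle);
a cdisprove seat extends this file (keep the landed/checked content, add `-- Targets` for line stubs).

Findings, all kernel-checked (rc 0, 0 sorry, axioms propext/Classical.choice/Quot.sound):
* `dyadicLatticeBetaLaw_of_cardyFormulaZ2` — **S → C**: the crux is a corollary of the summit conjunct
  `CardyFormulaZ2` (`a = 2/3`; `cardyFunction = I_{2/3}` on `[0,1]` is the tree theorem
  `cardyFunction_eq_incBeta13_div_holds`, Cardy 1992 eq. (8); dyadic meshes `h/2^k → 0⁺`). Consequently there is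
  no `¬ DyadicLatticeBetaLaw` and no `_false_without_<H>` lemma for the crux AS STATED unless Cardy's formula on ℤ²
  fails (Schramm 2006 ICM, Problem 2.11). Negative lemmas can only target STRENGTHENINGS or line stubs.
* `dyadicBetaLawAll_of_cardyFormulaZ2` / `dyadicLatticeBetaLaw_of_all` — load-bearing analysis: the lattice-polygon
  hypothesis and the dyadic-mesh restriction are pure weakenings relative to S (dropping them is still implied by S).
* `unitLatticeSquare_isLatticePolygon`, `dyadicLatticeBetaLaw_nonvacuous` — the hypothesis class is inhabited (open
  unit square at mesh 1; uniformizing data by `exists_isUniformizing_holds`): C is not vacuously true.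
* `tendsto_unitSquare_of_dyadicLatticeBetaLaw` — checkable content: C forces existence of
  `lim_k P_{1/2}[crossing of (0,1)² at mesh 2^{-k}]`.
Report: item evidence `CRUX-ATTACK.md` on stmt-CriticalPhenomena-18183.

## cdisprove cycle 1 (refuter-cdisprove-stmt-CriticalPhenomena-18183-0, 2026-08-17) — index of additions
(all rc 0, 0 sorry, axioms propext/Classical.choice/Quot.sound; sections at the end of the file)
* (a) LOAD-BEARING HYPOTHESES of the crux: `dyadicLatticeBetaLaw_false_without_isUniformizing`
  (`IsUniformizing` pins the value: dropping it forces limits `I_a(0) = 0` and `I_a(1) = 1` at once) —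
  LANDED as `Theorems/DyadicLatticeBetaLaw/Negative/DyadicLatticeBetaLawFalseWithoutUniformizing.lean`
  (p167300, ACCEPTED); `not_isLatticePolygonAt_zero` (`0 < h` is NOT load-bearing at `h = 0`: the lattice
  hypothesis is unsatisfiable there; `h < 0` is the `-ℤ²` reflection) — landed in the same file as
  `not_latticePolygon_mesh_zero`; lattice/dyadic restrictions: pure weakenings of S (seed section).
* (c) `isLatticePolygonAt_box`: EVERY lattice box `(0,hM) × (0,hN)` is a lattice polygon at mesh `h`
  (landed as `Negative.isLatticePolygon_box`; positively reusable by the line: boxes of all rational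
  aspect ratios are in the hypothesis class).
* Line `Sketch` (PICKED; skeleton registered 14:25Z; S2 `stub_subseqSandwich` already landed p166738):
  - S1 `stub_equicontinuousComparison`: `stubEquicontinuousComparison_of_cardyFormulaZ2` (**S → S1**:
    S1 is not refutable short of ¬Cardy-ℤ²); `stubEquicontinuousComparison_false_without_modulus`
    (**the two modulus hypotheses are load-bearing**: unit square `≥ 1/2` vs thin box `(0,1/4)×(0,1)`
    `≤ 1/8` along the same `k`; `half_le_bond_unitLatticeSquare`, `bond_thinBox_le` via the tree's
    `le_bond_bt`/`bond_bt_le`, self-duality and `LongBoxHalving_holds`);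
    `dyadicConsistency_of_stubEquicontinuousComparison` (S1 ⇒ ×2-consistency, the first open instance).
    LANDED as `Theorems/DyadicLatticeBetaLaw/Negative/StubEquicontinuousComparisonFalseWithoutModulus.lean`
    (p167872, ACCEPTED; decls `Negative.stub_equicontinuousComparison_of_cardyFormulaZ2`,
    `Negative.stub_equicontinuousComparison_false_without_modulus`,
    `Negative.dyadicConsistency_of_stub_equicontinuousComparison`, `Negative.half_le_bond_unitSquare`,
    `Negative.bond_thinBox_le`, `Negative.thinBox_isLatticePolygon`) — provers/planners: IMPORT the two
    landed `…Theorems.DyadicLatticeBetaLaw.Negative.*` modules rather than copying from this work file.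
  - S2/S5a/S5b/S3: paper audit only (docstring `lineSketch_audit` below): no formal glitch; S5a's
    `g + g' = 1` and all-real-`w` clauses are consistent with the G02 discretisation of boxes
    (left/right discrete arcs = extreme columns, `bond_lr_eq`); S5b's transfer from dyadic boxes to a
    general lattice polygon uses S1 at meshes `1/2^b` with index shift `k ↦ k - b` plus ×2-consistency
    links — consistent with S1's "same k, any h, h'" format.
* WHY IT RESISTS: every statement in the cone (C, S1, S5a, S2's conclusion) is implied by `CardyFormulaZ2`
  (+ RSW facts in the tree), and every decidable instance has `η = 1/2` (value `1/2` for all `a`);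
  a kill needs two lattice polygons of equal modulus with provably different dyadic limits, i.e. ¬Cardy-ℤ².
-/

open Filter Topology Set
open Literature.Probability.RandomPlanarGeometry Literature.Probability.Percolation
open Literature.Probability.LatticeModels

namespace Summit.CriticalPhenomena.CardyFormulaZ2.Cruxes.DyadicLatticeBetaLaw.Disproof

open Summit.CriticalPhenomena.CardyFormulaZ2.Theses.DyadicBetaRigidity

/-- The normalised incomplete beta law `I_a(η) = ∫₀^η (s(1-s))^{-a} / ∫₀¹ (s(1-s))^{-a}` of the crux. -/
noncomputable def betaLaw (a η : ℝ) : ℝ :=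
  (∫ s in (0 : ℝ)..η, (s * (1 - s)) ^ (-a)) / ∫ s in (0 : ℝ)..1, (s * (1 - s)) ^ (-a)

/-- The lattice-polygon hypothesis of the crux, named. -/
def IsLatticePolygonAt (h : ℝ) (R : ConformalRectangle) : Prop :=
  ∃ S : Finset (ℂ × ℂ), (∀ p ∈ S, ∃ u v : Site 2, (zdGraph 2).Adj u v ∧ p.1 = meshPoint h u ∧
    p.2 = meshPoint h v) ∧ frontier R.carrier ⊆ ⋃ p ∈ S, segment ℝ p.1 p.2

/-- The crux with the lattice-polygon hypothesis DROPPED (all conformal rectangles, dyadic meshes). -/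
def DyadicBetaLawAll : Prop :=
  ∃ a : ℝ, a ∈ Set.Ioo (0 : ℝ) 1 ∧ ∀ h : ℝ, 0 < h → ∀ R : ConformalRectangle,
    ∀ (φ : ConformalEquiv UpperHalfPlane.upperHalfPlaneSet R.carrier) (x : Fin 4 → ℝ),
      R.IsUniformizing φ x →
        Tendsto (fun k : ℕ => bondDomainCrossingProb R (h / 2 ^ k)) atTop
          (𝓝 (betaLaw a (crossRatio x)))

/-- Unfolding: the crux is literally `∃ a ∈ (0,1), ∀ h > 0, ∀ R, IsLatticePolygonAt h R → …`. -/
theorem dyadicLatticeBetaLaw_iff :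
    DyadicLatticeBetaLaw ↔ ∃ a : ℝ, a ∈ Set.Ioo (0 : ℝ) 1 ∧ ∀ h : ℝ, 0 < h →
      ∀ R : ConformalRectangle, IsLatticePolygonAt h R →
        ∀ (φ : ConformalEquiv UpperHalfPlane.upperHalfPlaneSet R.carrier) (x : Fin 4 → ℝ),
          R.IsUniformizing φ x →
            Tendsto (fun k : ℕ => bondDomainCrossingProb R (h / 2 ^ k)) atTop
              (𝓝 (betaLaw a (crossRatio x))) :=
  Iff.rfl

/-- Dyadic meshes `h / 2^k` tend to `0` from the right. -/
theorem tendsto_dyadicMesh {h : ℝ} (hh : 0 < h) :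
    Tendsto (fun k : ℕ => h / 2 ^ k) atTop (𝓝[>] (0 : ℝ)) := by
  rw [tendsto_nhdsWithin_iff]
  refine ⟨?_, Eventually.of_forall fun k => ?_⟩
  · exact tendsto_const_nhds.div_atTop (tendsto_pow_atTop_atTop_of_one_lt one_lt_two)
  · exact div_pos hh (pow_pos two_pos k)

/-- `cardyFunction = I_{2/3}` on `[0, 1]`, in the crux's inlined notation (tree theorem
`cardyFunction_eq_incBeta13_div_holds`, Cardy 1992 eq. (8)). -/
theorem cardyFunction_eq_betaLaw {η : ℝ} (hη : η ∈ Icc (0 : ℝ) 1) :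
    Literature.Probability.RandomPlanarGeometry.cardyFunction η = betaLaw (2 / 3) η :=
  cardyFunction_eq_incBeta13_div_holds η hη

/-- **S → C without the lattice hypothesis**: Cardy's formula on `ℤ²` gives the dyadic beta law with
`a = 2/3` for EVERY conformal rectangle. -/
theorem dyadicBetaLawAll_of_cardyFormulaZ2 (hS : _root_.CardyFormulaZ2) : DyadicBetaLawAll := by
  refine ⟨2 / 3, ⟨by norm_num, by norm_num⟩, ?_⟩
  intro h hh R φ x hφ
  have hη : crossRatio x ∈ Icc (0 : ℝ) 1 :=
    Ioo_subset_Icc_self (ConformalRectangle.crossRatio_mem_Ioo_of_isUniformizing hφ)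
  have hT := (hS R φ x hφ).comp (tendsto_dyadicMesh hh)
  rw [cardyFunction_eq_betaLaw hη] at hT
  exact hT

/-- Dropping the lattice-polygon hypothesis only strengthens: `DyadicBetaLawAll → DyadicLatticeBetaLaw`. -/
theorem dyadicLatticeBetaLaw_of_all (hA : DyadicBetaLawAll) : DyadicLatticeBetaLaw := by
  obtain ⟨a, ha, hA⟩ := hA
  exact ⟨a, ha, fun h hh R _ φ x hφ => hA h hh R φ x hφ⟩

/-- **S → C** (restates-the-summit probe): the crux `DyadicLatticeBetaLaw` is a corollary of the
summit conjunct `CardyFormulaZ2`, with exponent `a = 2/3`. -/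
theorem dyadicLatticeBetaLaw_of_cardyFormulaZ2 (hS : _root_.CardyFormulaZ2) : DyadicLatticeBetaLaw :=
  dyadicLatticeBetaLaw_of_all (dyadicBetaLawAll_of_cardyFormulaZ2 hS)

/-! ### Non-vacuity: the unit square is a lattice polygon at mesh 1 -/

/-- The open unit square `(0,1)²` with its four corners marked (tree: `rectQuad`). -/
noncomputable def unitLatticeSquare : ConformalRectangle :=
  rectQuad 0 1 0 1 zero_lt_one zero_lt_one

theorem unitLatticeSquare_carrier : unitLatticeSquare.carrier = Ioo 0 1 ×ℂ Ioo 0 1 :=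
  rectQuad_carrier _ _

theorem mem_frontier_unitLatticeSquare {p : ℂ} :
    p ∈ frontier unitLatticeSquare.carrier ↔
      ((0 ≤ p.re ∧ p.re ≤ 1) ∧ (p.im = 0 ∨ p.im = 1)) ∨
        ((p.re = 0 ∨ p.re = 1) ∧ (0 ≤ p.im ∧ p.im ≤ 1)) := by
  rw [unitLatticeSquare_carrier, Complex.frontier_reProdIm, closure_Ioo (by norm_num),
    frontier_Ioo (by norm_num), mem_union, Complex.mem_reProdIm, Complex.mem_reProdIm]
  simp only [mem_Icc, mem_insert_iff, mem_singleton_iff]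

/-- The four unit edges of `ℤ²` bounding the unit square, as pairs of endpoints. -/
noncomputable def squareEdges : Finset (ℂ × ℂ) :=
  {((0 : ℂ), (1 : ℂ)), ((1 : ℂ), 1 + Complex.I), (Complex.I, 1 + Complex.I), ((0 : ℂ), Complex.I)}

theorem meshPoint_one (u : Site 2) : meshPoint 1 u = ⟨u 0, u 1⟩ := by
  apply Complex.ext <;> simp

/-- **The unit square is a lattice polygon at mesh `1`.** -/
theorem unitLatticeSquare_isLatticePolygon : IsLatticePolygonAt 1 unitLatticeSquare := by
  refine ⟨squareEdges, ?_, ?_⟩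
  · intro p hp
    simp only [squareEdges, Finset.mem_insert, Finset.mem_singleton] at hp
    rcases hp with rfl | rfl | rfl | rfl
    · refine ⟨![0, 0], ![0, 0] + Pi.single 0 1, ⟨?_, ?_, ?_⟩⟩
      · exact (SimpleGraph.mem_edgeSet _).1 (single_edge_mem _ _)
      · rw [meshPoint_one]; apply Complex.ext <;> simp
      · rw [meshPoint_one]; apply Complex.ext <;> simp
    · refine ⟨![1, 0], ![1, 0] + Pi.single 1 1, ⟨?_, ?_, ?_⟩⟩
      · exact (SimpleGraph.mem_edgeSet _).1 (single_edge_mem _ _)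
      · rw [meshPoint_one]; apply Complex.ext <;> simp
      · rw [meshPoint_one]; apply Complex.ext <;> simp
    · refine ⟨![0, 1], ![0, 1] + Pi.single 0 1, ⟨?_, ?_, ?_⟩⟩
      · exact (SimpleGraph.mem_edgeSet _).1 (single_edge_mem _ _)
      · rw [meshPoint_one]; apply Complex.ext <;> simp
      · rw [meshPoint_one]; apply Complex.ext <;> simp
    · refine ⟨![0, 0], ![0, 0] + Pi.single 1 1, ⟨?_, ?_, ?_⟩⟩
      · exact (SimpleGraph.mem_edgeSet _).1 (single_edge_mem _ _)
      · rw [meshPoint_one]; apply Complex.ext <;> simp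
      · rw [meshPoint_one]; apply Complex.ext <;> simp
  · intro p hp
    rw [mem_frontier_unitLatticeSquare] at hp
    simp only [squareEdges, mem_iUnion, Finset.mem_insert, Finset.mem_singleton, exists_prop]
    rcases hp with ⟨⟨h0, h1⟩, him | him⟩ | ⟨hre | hre, h0, h1⟩
    · refine ⟨((0 : ℂ), (1 : ℂ)), Or.inl rfl, ?_⟩
      rw [mem_segment_iff_of_im_eq (by simp) (by simp)]
      exact ⟨by simpa using him, by simpa using And.intro h0 h1⟩
    · refine ⟨(Complex.I, 1 + Complex.I), Or.inr (Or.inr (Or.inl rfl)), ?_⟩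
      rw [mem_segment_iff_of_im_eq (by simp) (by simp)]
      exact ⟨by simpa using him, by simpa using And.intro h0 h1⟩
    · refine ⟨((0 : ℂ), Complex.I), Or.inr (Or.inr (Or.inr rfl)), ?_⟩
      rw [mem_segment_iff_of_re_eq (by simp) (by simp)]
      exact ⟨by simpa using hre, by simpa using And.intro h0 h1⟩
    · refine ⟨((1 : ℂ), 1 + Complex.I), Or.inr (Or.inl rfl), ?_⟩
      rw [mem_segment_iff_of_re_eq (by simp) (by simp)]
      exact ⟨by simpa using hre, by simpa using And.intro h0 h1⟩

/-- **Non-vacuity of the crux**: its universally quantified hypotheses (mesh `h > 0`, a conformal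
rectangle that is a lattice polygon at mesh `h`, a uniformizing datum `(φ, x)`) are simultaneously
satisfiable. -/
theorem dyadicLatticeBetaLaw_nonvacuous :
    ∃ (h : ℝ) (R : ConformalRectangle), 0 < h ∧ IsLatticePolygonAt h R ∧
      ∃ (φ : ConformalEquiv UpperHalfPlane.upperHalfPlaneSet R.carrier) (x : Fin 4 → ℝ),
        R.IsUniformizing φ x :=
  ⟨1, unitLatticeSquare, one_pos, unitLatticeSquare_isLatticePolygon,
    MarkedDomain.exists_isUniformizing_holds unitLatticeSquare⟩

/-- **Checkable content of the crux**: it forces the unit-square crossing probabilities along the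
meshes `2^{-k}` to converge (to `I_a(η)` for the square's modulus `η`). -/
theorem tendsto_unitSquare_of_dyadicLatticeBetaLaw (hC : DyadicLatticeBetaLaw) :
    ∃ a ∈ Set.Ioo (0 : ℝ) 1,
      ∀ (φ : ConformalEquiv UpperHalfPlane.upperHalfPlaneSet unitLatticeSquare.carrier)
        (x : Fin 4 → ℝ), unitLatticeSquare.IsUniformizing φ x →
        Tendsto (fun k : ℕ => bondDomainCrossingProb unitLatticeSquare (1 / 2 ^ k)) atTop
          (𝓝 (betaLaw a (crossRatio x))) := by
  obtain ⟨a, ha, hC⟩ := hC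
  exact ⟨a, ha, fun φ x hφ => hC 1 one_pos unitLatticeSquare unitLatticeSquare_isLatticePolygon φ x hφ⟩


/-! ## cdisprove cycle 1 (refuter-cdisprove-stmt-CriticalPhenomena-18183-0, 2026-08-17)

### (a) Load-bearing analysis of the crux's hypotheses

* `R.IsUniformizing φ x` — LOAD-BEARING: `dyadicLatticeBetaLaw_false_without_isUniformizing`.
* `0 < h` — NOT load-bearing at `h = 0` (`not_isLatticePolygonAt_zero`: the lattice hypothesis is
  unsatisfiable there); for `h < 0` the statement is the `h ↦ -h` reflection of itself (`-ℤ² = ℤ²`).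
* lattice-polygon hypothesis, dyadic restriction — pure weakenings of `CardyFormulaZ2`
  (`dyadicBetaLawAll_of_cardyFormulaZ2` above): droppable only together with Cardy's formula.
-/

/-- `I_a(0) = 0`. -/
theorem betaLaw_zero (a : ℝ) : betaLaw a 0 = 0 := by
  simp [betaLaw]

/-- `I_a(1) = 1` for `a < 1` (the complete beta integral is positive, tree lemma
`DyadicLattice.beta_pos`). -/
theorem betaLaw_one {a : ℝ} (ha : a < 1) : betaLaw a 1 = 1 := by
  rw [betaLaw, div_self (Theorems.DyadicLattice.beta_pos ha).ne']

/-- A degenerate (constant) quadruple has cross-ratio `0` (junk value of the division). -/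
theorem crossRatio_const (c : ℝ) : crossRatio (fun _ : Fin 4 => c) = 0 := by
  simp [crossRatio]

/-- The non-monotone quadruple `(0, 1, 1, 3)` has cross-ratio `1`. -/
theorem crossRatio_zero_one_one_three : crossRatio ![(0 : ℝ), 1, 1, 3] = 1 := by
  norm_num [crossRatio, Matrix.cons_val_two, Matrix.cons_val_three]

/-- The crux with the hypothesis `R.IsUniformizing φ x` DROPPED: the limit `I_a(crossRatio x)` is then
demanded for EVERY real quadruple `x`. -/
def DyadicLatticeBetaLawWithoutUniformizing : Prop :=
  ∃ a : ℝ, a ∈ Set.Ioo (0 : ℝ) 1 ∧ ∀ h : ℝ, 0 < h → ∀ R : ConformalRectangle, IsLatticePolygonAt h R →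
    ∀ (φ : ConformalEquiv UpperHalfPlane.upperHalfPlaneSet R.carrier) (x : Fin 4 → ℝ),
      Tendsto (fun k : ℕ => bondDomainCrossingProb R (h / 2 ^ k)) atTop (𝓝 (betaLaw a (crossRatio x)))

/-- **`IsUniformizing` is load-bearing**: without it the unit square's dyadic sequence would have to
converge both to `I_a(0) = 0` (constant quadruple) and to `I_a(1) = 1` (quadruple `(0,1,1,3)`). -/
theorem dyadicLatticeBetaLaw_false_without_isUniformizing : ¬ DyadicLatticeBetaLawWithoutUniformizing := by
  rintro ⟨a, ha, H⟩
  obtain ⟨φ, -, -⟩ := MarkedDomain.exists_isUniformizing_holds unitLatticeSquare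
  have h0 := H 1 one_pos unitLatticeSquare unitLatticeSquare_isLatticePolygon φ (fun _ => 0)
  have h1 := H 1 one_pos unitLatticeSquare unitLatticeSquare_isLatticePolygon φ ![(0 : ℝ), 1, 1, 3]
  rw [crossRatio_const, betaLaw_zero] at h0
  rw [crossRatio_zero_one_one_three, betaLaw_one ha.2] at h1
  have h01 := tendsto_nhds_unique h0 h1
  norm_num at h01

/-- **`0 < h` excludes nothing at `h = 0`**: at mesh `0` every lattice edge collapses to the point `0`,
and the frontier of a Jordan domain (which contains the two distinct marked points `pt 0 ≠ pt 1`) is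
not contained in `{0}`; so the lattice-polygon hypothesis is unsatisfiable at `h = 0`. -/
theorem not_isLatticePolygonAt_zero (R : ConformalRectangle) : ¬ IsLatticePolygonAt 0 R := by
  rintro ⟨S, hS, hfr⟩
  have hsub : frontier R.carrier ⊆ {(0 : ℂ)} := by
    intro p hp
    have hp' := hfr hp
    simp only [mem_iUnion, exists_prop] at hp'
    obtain ⟨q, hq, hpq⟩ := hp'
    obtain ⟨u, v, -, h1, h2⟩ := hS q hq
    have hq1 : q.1 = 0 := by rw [h1]; simp [meshPoint]
    have hq2 : q.2 = 0 := by rw [h2]; simp [meshPoint]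
    rw [hq1, hq2, segment_same ℝ] at hpq
    exact hpq
  have h0 : R.pt 0 = 0 := hsub (MarkedDomain.pt_mem_frontier R 0)
  have h1 : R.pt 1 = 0 := hsub (MarkedDomain.pt_mem_frontier R 1)
  have h01 : (0 : Fin 4) = 1 := MarkedDomain.pt_injective R (h0.trans h1.symm)
  exact absurd h01 (by decide)

/-! ### (c) Lattice boxes are lattice polygons (all integer boxes, all meshes) -/

/-- `(i, j + 1) = (i, j) + e₁` (companion of the tree's `pt_succ_eq`). -/
theorem pt_succ_eq_right (i j : ℤ) : pt i (j + 1) = pt i j + Pi.single 1 1 := by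
  ext k; fin_cases k <;> simp [pt]

/-- The horizontal lattice edge of `hℤ²` from `(i, j)` to `(i + 1, j)`, as a pair of endpoints. -/
def hEdge (h : ℝ) (i j : ℤ) : ℂ × ℂ :=
  (meshPoint h (pt i j), meshPoint h (pt (i + 1) j))

/-- The vertical lattice edge of `hℤ²` from `(i, j)` to `(i, j + 1)`, as a pair of endpoints. -/
def vEdge (h : ℝ) (i j : ℤ) : ℂ × ℂ :=
  (meshPoint h (pt i j), meshPoint h (pt i (j + 1)))

@[simp] theorem hEdge_fst_re (h : ℝ) (i j : ℤ) : (hEdge h i j).1.re = h * i := by simp [hEdge, pt]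
@[simp] theorem hEdge_fst_im (h : ℝ) (i j : ℤ) : (hEdge h i j).1.im = h * j := by simp [hEdge, pt]
@[simp] theorem hEdge_snd_re (h : ℝ) (i j : ℤ) : (hEdge h i j).2.re = h * (i + 1) := by
  simp [hEdge, pt]
@[simp] theorem hEdge_snd_im (h : ℝ) (i j : ℤ) : (hEdge h i j).2.im = h * j := by simp [hEdge, pt]
@[simp] theorem vEdge_fst_re (h : ℝ) (i j : ℤ) : (vEdge h i j).1.re = h * i := by simp [vEdge, pt]
@[simp] theorem vEdge_fst_im (h : ℝ) (i j : ℤ) : (vEdge h i j).1.im = h * j := by simp [vEdge, pt]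
@[simp] theorem vEdge_snd_re (h : ℝ) (i j : ℤ) : (vEdge h i j).2.re = h * i := by simp [vEdge, pt]
@[simp] theorem vEdge_snd_im (h : ℝ) (i j : ℤ) : (vEdge h i j).2.im = h * (j + 1) := by
  simp [vEdge, pt]

theorem hEdge_isEdge (h : ℝ) (i j : ℤ) : ∃ u v : Site 2, (zdGraph 2).Adj u v ∧
    (hEdge h i j).1 = meshPoint h u ∧ (hEdge h i j).2 = meshPoint h v :=
  ⟨pt i j, pt (i + 1) j, by rw [pt_succ_eq]; exact (SimpleGraph.mem_edgeSet _).1 (single_edge_mem _ _),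
    rfl, rfl⟩

theorem vEdge_isEdge (h : ℝ) (i j : ℤ) : ∃ u v : Site 2, (zdGraph 2).Adj u v ∧
    (vEdge h i j).1 = meshPoint h u ∧ (vEdge h i j).2 = meshPoint h v :=
  ⟨pt i j, pt i (j + 1), by rw [pt_succ_eq_right]; exact (SimpleGraph.mem_edgeSet _).1 (single_edge_mem _ _),
    rfl, rfl⟩

/-- The `2M + 2N` boundary edges of the box `[0, hM] × [0, hN]` in `hℤ²`. -/
noncomputable def boxEdges (h : ℝ) (M N : ℕ) : Finset (ℂ × ℂ) :=
  ((Finset.range M).image fun i : ℕ => hEdge h i 0) ∪ ((Finset.range M).image fun i : ℕ => hEdge h i N) ∪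
    (((Finset.range N).image fun j : ℕ => vEdge h 0 j) ∪ ((Finset.range N).image fun j : ℕ => vEdge h M j))

/-- Windows: a real `t ∈ [0, M]`, `M ≥ 1`, lies in some `[i, i + 1]` with `i < M`. -/
theorem exists_unit_window {t : ℝ} {M : ℕ} (hM : 0 < M) (h0 : 0 ≤ t) (h1 : t ≤ M) :
    ∃ i : ℕ, i < M ∧ (i : ℝ) ≤ t ∧ t ≤ i + 1 := by
  rcases lt_or_eq_of_le h1 with hlt | heq
  · exact ⟨⌊t⌋₊, (Nat.floor_lt h0).2 hlt, Nat.floor_le h0, (Nat.lt_floor_add_one t).le⟩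
  · refine ⟨M - 1, Nat.sub_lt hM one_pos, ?_, ?_⟩
    · rw [heq, Nat.cast_sub (by omega : 1 ≤ M)]; push_cast; linarith
    · rw [heq, Nat.cast_sub (by omega : 1 ≤ M)]; push_cast; linarith

/-- **Every lattice box is a lattice polygon**: a conformal rectangle whose carrier is the open box
`(0, hM) × (0, hN)` (`M, N ≥ 1` integers, marks anywhere) has its frontier covered by the `2M + 2N`
edges `boxEdges h M N` of `hℤ²`. -/
theorem isLatticePolygonAt_box {h : ℝ} (hh : 0 < h) {M N : ℕ} (hM : 0 < M) (hN : 0 < N)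
    (R : ConformalRectangle) (hR : R.carrier = (Ioo (0 : ℝ) (h * M) ×ℂ Ioo (0 : ℝ) (h * N))) :
    IsLatticePolygonAt h R := by
  have hMr : (0 : ℝ) < h * M := mul_pos hh (by exact_mod_cast hM)
  have hNr : (0 : ℝ) < h * N := mul_pos hh (by exact_mod_cast hN)
  refine ⟨boxEdges h M N, ?_, ?_⟩
  · intro p hp
    simp only [boxEdges, Finset.mem_union, Finset.mem_image, Finset.mem_range] at hp
    rcases hp with (⟨i, -, rfl⟩ | ⟨i, -, rfl⟩) | (⟨j, -, rfl⟩ | ⟨j, -, rfl⟩)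
    · exact hEdge_isEdge h i 0
    · exact hEdge_isEdge h i N
    · exact vEdge_isEdge h 0 j
    · exact vEdge_isEdge h M j
  · intro p hp
    rw [hR, Complex.frontier_reProdIm, closure_Ioo hMr.ne, frontier_Ioo hMr, closure_Ioo hNr.ne,
      frontier_Ioo hNr, mem_union, Complex.mem_reProdIm, Complex.mem_reProdIm] at hp
    simp only [mem_Icc, mem_insert_iff, mem_singleton_iff] at hp
    rcases hp with ⟨⟨h0, h1⟩, him⟩ | ⟨hre, h0, h1⟩
    · -- bottom or top side: window in the real part
      obtain ⟨i, hiM, hi1, hi2⟩ := exists_unit_window (t := p.re / h) hM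
        (div_nonneg h0 hh.le) (by rwa [div_le_iff₀ hh, mul_comm])
      have hi1' : h * i ≤ p.re := by rwa [le_div_iff₀ hh, mul_comm] at hi1
      have hi2' : p.re ≤ h * (i + 1) := by rwa [div_le_iff₀ hh, mul_comm] at hi2
      have hle : (hEdge h i 0).1.re ≤ (hEdge h i 0).2.re := by
        simp only [hEdge_fst_re, hEdge_snd_re]; nlinarith
      have hleN : (hEdge h i N).1.re ≤ (hEdge h i N).2.re := by
        simp only [hEdge_fst_re, hEdge_snd_re]; nlinarith
      rcases him with him | him
      · have hmem : hEdge h i 0 ∈ boxEdges h M N :=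
          Finset.mem_union_left _ (Finset.mem_union_left _
            (Finset.mem_image.2 ⟨i, Finset.mem_range.2 hiM, rfl⟩))
        refine mem_iUnion₂_of_mem hmem ?_
        rw [mem_segment_iff_of_im_eq hle (by simp)]
        simp only [hEdge_fst_im, hEdge_fst_re, hEdge_snd_re, Int.cast_natCast, Int.cast_zero,
          mul_zero, mem_Icc]
        exact ⟨him, hi1', hi2'⟩
      · have hmem : hEdge h i N ∈ boxEdges h M N :=
          Finset.mem_union_left _ (Finset.mem_union_right _
            (Finset.mem_image.2 ⟨i, Finset.mem_range.2 hiM, rfl⟩))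
        refine mem_iUnion₂_of_mem hmem ?_
        rw [mem_segment_iff_of_im_eq hleN (by simp)]
        simp only [hEdge_fst_im, hEdge_fst_re, hEdge_snd_re, Int.cast_natCast, mem_Icc]
        exact ⟨him, hi1', hi2'⟩
    · -- left or right side: window in the imaginary part
      obtain ⟨j, hjN, hj1, hj2⟩ := exists_unit_window (t := p.im / h) hN
        (div_nonneg h0 hh.le) (by rwa [div_le_iff₀ hh, mul_comm])
      have hj1' : h * j ≤ p.im := by rwa [le_div_iff₀ hh, mul_comm] at hj1
      have hj2' : p.im ≤ h * (j + 1) := by rwa [div_le_iff₀ hh, mul_comm] at hj2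
      have hle : (vEdge h 0 j).1.im ≤ (vEdge h 0 j).2.im := by
        simp only [vEdge_fst_im, vEdge_snd_im]; nlinarith
      have hleM : (vEdge h M j).1.im ≤ (vEdge h M j).2.im := by
        simp only [vEdge_fst_im, vEdge_snd_im]; nlinarith
      rcases hre with hre | hre
      · have hmem : vEdge h 0 j ∈ boxEdges h M N :=
          Finset.mem_union_right _ (Finset.mem_union_left _
            (Finset.mem_image.2 ⟨j, Finset.mem_range.2 hjN, rfl⟩))
        refine mem_iUnion₂_of_mem hmem ?_
        rw [mem_segment_iff_of_re_eq hle (by simp)]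
        simp only [vEdge_fst_re, vEdge_fst_im, vEdge_snd_im, Int.cast_natCast, Int.cast_zero,
          mul_zero, mem_Icc]
        exact ⟨hre, hj1', hj2'⟩
      · have hmem : vEdge h M j ∈ boxEdges h M N :=
          Finset.mem_union_right _ (Finset.mem_union_right _
            (Finset.mem_image.2 ⟨j, Finset.mem_range.2 hjN, rfl⟩))
        refine mem_iUnion₂_of_mem hmem ?_
        rw [mem_segment_iff_of_re_eq hleM (by simp)]
        simp only [vEdge_fst_re, vEdge_fst_im, vEdge_snd_im, Int.cast_natCast, mem_Icc]
        exact ⟨hre, hj1', hj2'⟩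

/-! ## Line `Sketch` (PICKED 2026-08-17; idea `equimodular-comparison`) — stub attacks

Paper audit of the other stubs (no Lean content; recorded for the lead):
* S2 `stub_subseqSandwich` — LANDED by the lead (p166738). Nothing to attack.
* S5a `stub_rectSubseqLimits` — G02 discretisation of `(0,w) × (0,1)` at mesh `δ = 2^{-m}`: interior
  sites `[1, ⌈w/δ⌉-1] × [1, 2^m - 1]`, mesh graph = full induced graph (no edge crosses the boundary),
  discrete left/right arcs = extreme columns (corner ties by the `≤` rule are harmless), so
  `P[Q w] = crossingProb half a b` exactly (`bond_lr_eq`) and `P[Q' w]` is sandwiched (`bond_bt_le`,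
  `le_bond_bt`); `g + g' = 1` in the limit is exact duality up to one row/column, absorbed by the
  mesh-uniform increment lemma; all-real-`w` + continuity of `g` by diagonal extraction. Consistent.
* S5b `stub_clusterLawOfComparison` — the transfer from boxes `Q w_m` (dyadic `w_m`, lattice polygons
  at mesh `1/2^b`) to a general lattice polygon `P` uses S1 at EQUAL `k` with `h' = 1/2^b'` (`b' ≥ b`),
  i.e. the index shift `k = κσn - b'`, reaching every shifted ladder `h 2^j / 2^(κσn)` of `P`; finitely
  many ×2-consistency links each cost an arbitrary `ε`; continuity of `g` closes the `w_m → w` limit;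
  symmetry from `Q'`. Consistent with S1's format — no gap found in `DyadicLatticeBetaLaw_of`.
* S3 `stub_cardyRigiditySeq` = item stmt-4680 verbatim; hypothesis not instantiable by any explicit
  `(u, f)`; out of scope here.

### S1 `stub_equicontinuousComparison` -/

/-- STUB S1 of `Lines/Sketch.lean`, restated verbatim (with the lattice hypothesis abbreviated by the
definitionally equal `IsLatticePolygonAt`). -/
def StubEquicontinuousComparison : Prop :=
  ∀ ε : ℝ, 0 < ε → ∀ η ∈ Set.Ioo (0 : ℝ) 1, ∃ θ : ℝ, 0 < θ ∧
    ∀ h h' : ℝ, 0 < h → 0 < h' → ∀ R R' : ConformalRectangle,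
      IsLatticePolygonAt h R → IsLatticePolygonAt h' R' →
      ∀ (φ : ConformalEquiv UpperHalfPlane.upperHalfPlaneSet R.carrier) (x : Fin 4 → ℝ)
        (φ' : ConformalEquiv UpperHalfPlane.upperHalfPlaneSet R'.carrier) (x' : Fin 4 → ℝ),
        R.IsUniformizing φ x → R'.IsUniformizing φ' x' →
        |crossRatio x - η| < θ → |crossRatio x' - η| < θ →
        ∀ᶠ k : ℕ in atTop,
          |bondDomainCrossingProb R (h / 2 ^ k) - bondDomainCrossingProb R' (h' / 2 ^ k)| < ε

/-- **`CardyFormulaZ2 → S1`**: the hard stub of the picked line is a consequence of Cardy's formula on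
`ℤ²` (uniform continuity of `F` on `[0,1]`, tree: `continuousOn_cardyFunction_holds`), hence — like the
crux — not refutable short of `¬ CardyFormulaZ2`. -/
theorem stubEquicontinuousComparison_of_cardyFormulaZ2 (hS : _root_.CardyFormulaZ2) :
    StubEquicontinuousComparison := by
  intro ε hε η _
  obtain ⟨θ, hθ, hU⟩ := Metric.uniformContinuousOn_iff.1
    (isCompact_Icc.uniformContinuousOn_of_continuous continuousOn_cardyFunction_holds) (ε / 2)
    (half_pos hε)
  refine ⟨θ / 2, half_pos hθ, ?_⟩
  intro h h' hh hh' R R' _ _ φ x φ' x' hφ hφ' hx hx'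
  have hηR := ConformalRectangle.crossRatio_mem_Ioo_of_isUniformizing hφ
  have hηR' := ConformalRectangle.crossRatio_mem_Ioo_of_isUniformizing hφ'
  have hF : dist (Literature.Probability.RandomPlanarGeometry.cardyFunction (crossRatio x))
      (Literature.Probability.RandomPlanarGeometry.cardyFunction (crossRatio x')) < ε / 2 := by
    refine hU _ (Ioo_subset_Icc_self hηR) _ (Ioo_subset_Icc_self hηR') ?_
    rw [Real.dist_eq]
    calc |crossRatio x - crossRatio x'| = |(crossRatio x - η) - (crossRatio x' - η)| := by ring_nf
      _ ≤ |crossRatio x - η| + |crossRatio x' - η| := abs_sub _ _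
      _ < θ := by linarith
  have hT := Metric.tendsto_nhds.1 ((hS R φ x hφ).comp (tendsto_dyadicMesh hh)) (ε / 4) (by positivity)
  have hT' := Metric.tendsto_nhds.1 ((hS R' φ' x' hφ').comp (tendsto_dyadicMesh hh')) (ε / 4)
    (by positivity)
  filter_upwards [hT, hT'] with k hk hk'
  rw [Function.comp_apply, Real.dist_eq] at hk hk'
  rw [Real.dist_eq] at hF
  have e1 := abs_lt.1 hk
  have e2 := abs_lt.1 hk'
  have e3 := abs_lt.1 hF
  rw [abs_lt]
  constructor <;> linarith [e1.1, e1.2, e2.1, e2.2, e3.1, e3.2]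

/-- S1 with its two modulus-closeness hypotheses `|crossRatio x - η| < θ`, `|crossRatio x' - η| < θ`
DROPPED (so `η`, `θ` become idle): ANY two lattice polygons would be asymptotically indistinguishable. -/
def StubEquicontinuousComparisonWithoutModulus : Prop :=
  ∀ ε : ℝ, 0 < ε → ∀ η ∈ Set.Ioo (0 : ℝ) 1, ∃ θ : ℝ, 0 < θ ∧
    ∀ h h' : ℝ, 0 < h → 0 < h' → ∀ R R' : ConformalRectangle,
      IsLatticePolygonAt h R → IsLatticePolygonAt h' R' →
      ∀ (φ : ConformalEquiv UpperHalfPlane.upperHalfPlaneSet R.carrier) (x : Fin 4 → ℝ)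
        (φ' : ConformalEquiv UpperHalfPlane.upperHalfPlaneSet R'.carrier) (x' : Fin 4 → ℝ),
        R.IsUniformizing φ x → R'.IsUniformizing φ' x' →
        ∀ᶠ k : ℕ in atTop,
          |bondDomainCrossingProb R (h / 2 ^ k) - bondDomainCrossingProb R' (h' / 2 ^ k)| < ε

/-- The thin box `(0, 1/4) × (0, 1)` with its corners marked (arcs `0`, `2` = bottom, top): a lattice
polygon of `(1/4)ℤ²` crossed bottom-to-top with probability `≤ 1/8` at every dyadic refinement. -/
noncomputable def thinBox : ConformalRectangle :=
  rectQuad 0 (1 / 4) 0 1 (by norm_num) zero_lt_one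

theorem thinBox_isLatticePolygon : IsLatticePolygonAt (1 / 4) thinBox :=
  isLatticePolygonAt_box (M := 1) (N := 4) (by norm_num) one_pos (by norm_num) thinBox
    (by rw [thinBox, rectQuad_carrier]; norm_num)

theorem unitLatticeSquare_arc_zero :
    unitLatticeSquare.arc 0 = {z : ℂ | z.im = 0 ∧ z.re ∈ Icc (0 : ℝ) 1} := by
  ext z; exact mem_rectQuad_arc_zero zero_lt_one zero_lt_one

theorem unitLatticeSquare_arc_two :
    unitLatticeSquare.arc 2 = {z : ℂ | z.im = 1 ∧ z.re ∈ Icc (0 : ℝ) 1} := by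
  ext z; exact mem_rectQuad_arc_two zero_lt_one zero_lt_one

theorem thinBox_carrier : thinBox.carrier = (Ioo (0 : ℝ) (1 / 4) ×ℂ Ioo (0 : ℝ) 1) :=
  rectQuad_carrier _ _

theorem thinBox_arc_zero : thinBox.arc 0 = {z : ℂ | z.im = 0 ∧ z.re ∈ Icc (0 : ℝ) (1 / 4)} := by
  ext z; exact mem_rectQuad_arc_zero (by norm_num) zero_lt_one

theorem thinBox_arc_two : thinBox.arc 2 = {z : ℂ | z.im = 1 ∧ z.re ∈ Icc (0 : ℝ) (1 / 4)} := by
  ext z; exact mem_rectQuad_arc_two (by norm_num) zero_lt_one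

/-- **The unit square is crossed with probability `≥ 1/2`** at every mesh `1/(n+3)` (its crossing event
contains the bottom-top crossing of the lattice box `[0, n] × [0, n+1]`, of probability
`crossingProb half (n+1) n = 1/2` by self-duality; tree: `le_bond_bt`, `crossingProb_half_succ_self_holds`). -/
theorem half_le_bond_unitLatticeSquare (n : ℕ) :
    1 / 2 ≤ bondDomainCrossingProb unitLatticeSquare (1 / ((n : ℝ) + 3)) := by
  have hn : (0 : ℝ) < n + 3 := by positivity
  have hδ : (0 : ℝ) < 1 / (n + 3) := by positivity
  have ha : 1 / ((n : ℝ) + 3) * ((n + 1 : ℕ) + 1) < 1 := by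
    rw [div_mul_eq_mul_div, one_mul, div_lt_one hn]; push_cast; linarith
  have ha' : (1 : ℝ) ≤ 1 / ((n : ℝ) + 3) * ((n + 1 : ℕ) + 2) := by
    rw [div_mul_eq_mul_div, one_mul, le_div_iff₀ hn]; push_cast; linarith
  have hb : 1 / ((n : ℝ) + 3) * ((n + 1 : ℕ) + 2) = 1 := by
    push_cast; field_simp; ring
  have hlow := Summit.CriticalPhenomena.CardyFormulaZ2.Cruxes.SimilarityUpgrade.Stubs.RectangleDuality.le_bond_bt
    unitLatticeSquare unitLatticeSquare_carrier unitLatticeSquare_arc_zero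
    unitLatticeSquare_arc_two hδ ha ha' hb (a' := n) le_rfl
  rw [Summit.CriticalPhenomena.CardyFormulaZ2.Cruxes.SimilarityUpgrade.Stubs.RectangleDuality.real_shift_tbCrossing]
    at hlow
  rw [← crossingProb_half_succ_self_holds n]
  exact hlow

/-- **The thin box is crossed bottom-to-top with probability `≤ 1/8`** at every mesh `1/(4(n+2))`
(its crossing event is contained in the bottom-top crossing of the lattice box `[0, n] × [0, 4n+6]`,
i.e. a left-right crossing of `[0, 4n+6] × [0, n]`, of probability `≤ crossingProb half (3(n+2)-1) n ≤ 1/8`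
by `LongBoxHalving_holds`; tree: `bond_bt_le`, `crossingProb_anti_left`). -/
theorem bond_thinBox_le (n : ℕ) :
    bondDomainCrossingProb thinBox (1 / (4 * ((n : ℝ) + 2))) ≤ 1 / 8 := by
  have hn : (0 : ℝ) < 4 * (n + 2) := by positivity
  have hδ : (0 : ℝ) < 1 / (4 * (n + 2)) := by positivity
  have ha : 1 / (4 * ((n : ℝ) + 2)) * ((n : ℕ) + 1) < 1 / 4 := by
    rw [div_mul_eq_mul_div, one_mul, div_lt_iff₀ hn]; linarith
  have ha' : (1 : ℝ) / 4 ≤ 1 / (4 * ((n : ℝ) + 2)) * ((n : ℕ) + 2) := by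
    rw [div_mul_eq_mul_div, one_mul, le_div_iff₀ hn]; linarith
  have hb : 1 / (4 * ((n : ℝ) + 2)) * ((4 * n + 6 : ℕ) + 2) = 1 := by
    push_cast; field_simp; ring
  have hup := Summit.CriticalPhenomena.CardyFormulaZ2.Cruxes.SimilarityUpgrade.Stubs.RectangleDuality.bond_bt_le
    thinBox thinBox_carrier thinBox_arc_zero thinBox_arc_two hδ ha ha' hb
  rw [Summit.CriticalPhenomena.CardyFormulaZ2.Cruxes.SimilarityUpgrade.Stubs.RectangleDuality.real_shift_tbCrossing]
    at hup
  refine hup.trans ?_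
  have h1 : crossingProb half (4 * n + 6) n ≤ crossingProb half (3 * (n + 2) - 1) n :=
    crossingProb_anti_left half (by omega) n
  have h2 := Literature.Barriers.CriticalPhenomena.LongBoxHalving_holds 3 n
  exact h1.trans (h2.trans_eq (by norm_num))

/-- **The modulus hypotheses of S1 are load-bearing**: the unit square (`≥ 1/2` along `1/2^k`) and the
thin box `(0,1/4) × (0,1)` (`≤ 1/8` along `(1/4)/2^k`) are lattice polygons of `ℤ²` resp. `(1/4)ℤ²`
whose dyadic crossing probabilities stay `≥ 3/8` apart. -/
theorem stubEquicontinuousComparison_false_without_modulus :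
    ¬ StubEquicontinuousComparisonWithoutModulus := by
  intro H
  obtain ⟨θ, -, H⟩ := H (1 / 4) (by norm_num) (1 / 2) ⟨by norm_num, by norm_num⟩
  obtain ⟨φ, x, hφ⟩ := MarkedDomain.exists_isUniformizing_holds unitLatticeSquare
  obtain ⟨φ', x', hφ'⟩ := MarkedDomain.exists_isUniformizing_holds thinBox
  have hev := H 1 (1 / 4) one_pos (by norm_num) unitLatticeSquare thinBox
    unitLatticeSquare_isLatticePolygon thinBox_isLatticePolygon φ x φ' x' hφ hφ'
  obtain ⟨k, hk2, hk⟩ := ((eventually_ge_atTop 2).and hev).exists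
  have h4 : 4 ≤ 2 ^ k := by
    calc 4 = 2 ^ 2 := by norm_num
      _ ≤ 2 ^ k := Nat.pow_le_pow_right (by norm_num) hk2
  obtain ⟨n, hn⟩ : ∃ n : ℕ, (2 : ℝ) ^ k = n + 3 :=
    ⟨2 ^ k - 3, by rw [Nat.cast_sub (by omega)]; push_cast; ring⟩
  obtain ⟨n', hn'⟩ : ∃ n' : ℕ, (2 : ℝ) ^ k = n' + 2 :=
    ⟨2 ^ k - 2, by rw [Nat.cast_sub (by omega)]; push_cast; ring⟩
  have e1 : (1 : ℝ) / 2 ^ k = 1 / ((n : ℝ) + 3) := by rw [hn]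
  have e2 : (1 : ℝ) / 4 / 2 ^ k = 1 / (4 * ((n' : ℝ) + 2)) := by rw [hn', div_div]
  rw [e1, e2] at hk
  have hlo := half_le_bond_unitLatticeSquare n
  have hhi := bond_thinBox_le n'
  have := (abs_lt.1 hk).2
  linarith

/-- S1 specialised to `R' = R` presented at the next dyadic mesh (`h' = h/2`): dyadic ×2-consistency
`P[R, h/2^k] - P[R, h/2^(k+1)] → 0` for every lattice polygon — the census's "first open instance"
(existence of `lim_k P[2×1 rectangle, 2^{-k}]` is not known). Recorded as the cheapest consequence of
S1 that is not a consequence of RSW/duality alone. -/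
theorem dyadicConsistency_of_stubEquicontinuousComparison (hS1 : StubEquicontinuousComparison)
    {h : ℝ} (hh : 0 < h) (R : ConformalRectangle) (hR : IsLatticePolygonAt h R)
    (hR' : IsLatticePolygonAt (h / 2) R) (φ : ConformalEquiv UpperHalfPlane.upperHalfPlaneSet R.carrier)
    (x : Fin 4 → ℝ) (hφ : R.IsUniformizing φ x) (ε : ℝ) (hε : 0 < ε) :
    ∀ᶠ k : ℕ in atTop,
      |bondDomainCrossingProb R (h / 2 ^ k) - bondDomainCrossingProb R (h / 2 ^ (k + 1))| < ε := by
  have hη := ConformalRectangle.crossRatio_mem_Ioo_of_isUniformizing hφ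
  obtain ⟨θ, hθ, H⟩ := hS1 ε hε (crossRatio x) hη
  have hev := H h (h / 2) hh (half_pos hh) R R hR hR' φ x φ x hφ hφ (by simpa using hθ) (by simpa using hθ)
  filter_upwards [hev] with k hk
  have e : h / 2 / 2 ^ k = h / 2 ^ (k + 1) := by rw [pow_succ]; ring
  rwa [e] at hk

end Summit.CriticalPhenomena.CardyFormulaZ2.Cruxes.DyadicLatticeBetaLaw.Disproof
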